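import Summits.QuantumFields.YangMills.Theorems.AlphaInputsT3ACv3AbelianSmall
import Literature.MathematicalPhysics.QuantumFieldTheory.Balaban1983to89.T3PrintedRegularOrbits
import Literature.MathematicalPhysics.QuantumFieldTheory.Balaban1983to89.B9AdOrthogonal
import Summits.QuantumFields.YangMills.Theorems.UnitScaleTiltMinimiserStabilityRegPrAvgActionDefect
import Summits.QuantumFields.YangMills.Theorems.UnitScaleTiltProp7SymCentreAbelianDict
import HarnessLib

/-!
# Route `UnitScaleTilt`, crux K1 child «MinimiserStabilityRegPr» (stmt-QuantumFields-19200), stub `stub_existenceMinimalOrbit` (EX), route (α), line «SYM-CENTRE»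
# (★★OWNER RULING g28-№7 cure (ii-a); px20 g2 LOCATE #56, row (R4); word «w4-20520 g9: R4-FIBRE GO» 2026-08-28T22:31:19Z) — **R4-FIBRE: THE ABELIAN CONFIGURATION
# OF AN EXACT FINE LIFT LIES IN THE AVERAGING FIBRE OF THE DIAGONAL COARSE FIELD, EXACTLY**

Cell `ym3-torus`, width seat `ym-ust-20520-w4` (gen 9).  THEOREMS ONLY (0 `def`, 0 `sorry`).  `--supports stmt-QuantumFields-19200 --as helper`, count-neutral.
YM₃ on T³ is a ladder rung (R3), not the Clay problem; nothing here claims the stub, the crux, d = 4 or the mass gap.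

THE POINT.  The (R4) assembly of the SYM-CENTRE line (`hSymCentre_of_reducible`; shell ✓`Prop7NestedMeanParallelLiftDiagGauge.exists_symCentre_of_diagonalSupplier`)
must SUPPLY, for a σ₃-diagonal coarse field `V′ = diag(e^{iθ}, e^{−iθ})`, a fine field `U₁ ∈ fibre F ℰp n K h V′` (plus `RegPr`, R4-DICT ★px19, and `hLift`,
✓`hLift_of_parallelConstCommuting` ★px20).  The candidate is the ABELIAN configuration `U_a := diag(e^{ia}, e^{−ia})` of a finest real one-form `a` whose `(K−n)`-fold
(0.4)-LINEAR average is `θ` EXACTLY (★px19 ✓`LinearLiftSpreadLip.exists_smoothExactLift_torus`, FLUX-LIFT ★w5-20520 g8).  THIS FILE proves the fibre membership: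
the printed `exp[mean log]` block averaging `descendTo F ℰp n K h` of `U_a` IS `diag(e^{iθ}, e^{−iθ})` on the nose — by ★alpha-2's kernel theorem
✓`AbelianEML.iter_blockAvg_gexpAt` (the `s`-fold (0.4)/`exp[mean log]` average of a small-CURL abelian configuration is the abelian configuration of the `s`-fold linear
average `linAvgIter s`, whose comb∕staircase contributions are part of `linAvgIter` — ✓`AbelianEML.linAvgIter_eq_tubeSum_sub_cobd`), read through the level
identification `fieldShift (sites_eq F n K h)` of ✓`T3TiltDescent.descendTo`.  The GUARD IS A CURL GUARD (gauge invariant): `|curl a| ≤ B` on the finest lattice and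
`(π/2)·((5L)²/4)·(L²)^{K−n}·B·‖Y‖ < min(δ₂, ln 2)`; numerically `30·L²·(L²)^{K−n}·B ≤ 1` suffices for the direction `Y = iσ₃` (§3; `δ₂ = 1/3`).  With ★px19's exponents
(`|curl a| ≤ 54³·ε/(Lᵏ)²`) the window reads `30·54³·L²·ε ≤ 1`, `k`-UNIFORM.

WHAT IS PROVED (sorry-free, no definition; ns `…Theorems.Prop7SymCentreAbelianFibre`):
* §1 (any `SU(N)`, any direction `Y ∈ 𝔰𝔲(N)`, `Y ≠ 0`; averaging `expMeanLogSU`): ★★ `descendTo_gexpAt_eq_fieldShift` — `descendTo F 𝓔 n K h (gexpAt Y a) =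
  fieldShift (sites_eq F n K h) (gexpAt Y (linAvgIter (K − n) a))`; ★★ `gexpAt_mem_fibre_gexpAt` — if `linAvgIter (K−n) a (bondShift (sites_eq F n K h) c) = θ c` for every
  coarse bond `c` then `gexpAt Y a ∈ fibre F 𝓔 n K h (gexpAt Y θ)`; `gaugeAct_gexpAt_mem_fibre` — the gauge-transported form (✓`gaugeAct_mem_fibre_iff`).  §1c (LOOP-SUM-GUARD form,
  no curl row: e.g. a flux cochain in standard form, whose (0.4) loops avoid the corner column — ★w5-20520 g8's located geometry): ★★ `iter_blockAvg_gexpAt_of_loopSum_lt` (generic `P`),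
  ★★ `descendTo_gexpAt_eq_fieldShift_of_loopSum_lt`, `gexpAt_mem_fibre_gexpAt_of_loopSum_lt`.  (The REGIONAL form — curl small only under a nested region — is the sibling file
  `…SymCentreAbelianFibreRegion`.)
* §2 the direction `iσ₃` (the letter `I_smul_sigma3_mem_lie` is ★px19's ✓`Prop7SymCentreAbelianDict`, imported — ONE proof term in the tree): `I_smul_sigma3_ne_zero`, `norm_I_smul_sigma3` (`= 1`), ★ `coe_gexp_I_smul_sigma3` (`= Matrix.diagonal ![e^{it}, e^{−it}]`),
  `commute_coe_gexp_I_smul_sigma3_sigma3`, ★ `exists_eq_gexp_of_commute_sigma3` ∕ `exists_eq_gexpAt_of_forall_commute_sigma3` (an `SU(2)`-valued field whose bond variables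
  commute with `σ₃` IS `gexpAt (iσ₃) θ` for a real angle field `θ` — the letters of ✓`exists_symCentre_of_diagonalSupplier`'s `hSup`), `gexp(At)_I_smul_sigma3_add_two_pi_mul_int`
  (2π-periodicity: string relocation does not change the field); `δ₂ = 1/3` is ✓`AvgActionDefect.deltaSU_fin_two`.
* §3 (T³ letters, `ℰp`, `SU(2)`, direction `iσ₃`, numeric window `30·L²·(L²)^{K−n}·B ≤ 1`, curl guard in the `μ ≠ ν` form of ✓p674080): ★★★ `descendTo_diag_eq_T3`,
  ★★★ `diag_mem_fibre_diag_T3` (R4-FIBRE as worded), `gaugeAct_diag_mem_fibre_T3`, ★★★ `diag_mem_fibre_diag_of_loopSum_T3` (guards `3·|loopSum| < 1`, no curl row).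
HONEST SCOPE.  Kernel bookkeeping over landed theorems (★alpha-2's abelian `exp[mean log]` calculus + the descent's definition); no estimate of [7]∕[4] is asserted; `RegPr`
of `U_a` (R4-DICT), the lift `a` (R3∕FLUX-LIFT), `hLift` and the assembly are the line's other rows, not here; no stub ∕ crux statement is advanced.

References: T. Bałaban, CMP 109 (1987) [Balaban1987RG1] ((0.4), (0.11) p.253); CMP 98 (1985) [Balaban1985Averaging] ((8)–(14) p.19); CMP 102 (1985) [Balaban1985Variational] ((2)–(7) p.278).
-/

set_option autoImplicit false

noncomputable section

open scoped BigOperators Matrix.Norms.L2Operator Matrix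

namespace Summit.QuantumFields.YangMills.Theorems.Prop7SymCentreAbelianFibre

open Literature.MathematicalPhysics.QuantumFieldTheory.Balaban1983to89
open Literature.MathematicalPhysics.QuantumFieldTheory.Balaban1983to89.T4Continuum
open Literature.MathematicalPhysics.QuantumFieldTheory.Balaban1983to89.T3ContinuumYM3Torus (T3Family)
open Literature.MathematicalPhysics.QuantumFieldTheory.Balaban1983to89.T3TiltDescent (descendTo)
open Literature.MathematicalPhysics.QuantumFieldTheory.Balaban1983to89.T3ConstrainedMinimiser (fibre)
open Literature.MathematicalPhysics.QuantumFieldTheory.Balaban1983to89.T3PrintedRegularOrbits (sites_eq descTransf descendTo_gaugeAct gaugeAct_mem_fibre_iff)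
open Literature.MathematicalPhysics.QuantumFieldTheory.Balaban1983to89.T3LevelShift (fieldShift bondShift fieldShift_apply)
open Literature.MathematicalPhysics.QuantumFieldTheory.Balaban1983to89.T3UnitLawDensityEML (ℰp)
open Literature.MathematicalPhysics.QuantumFieldTheory.Balaban1983to89.ExpMeanLog (expMeanLogSU deltaSU)
open Literature.MathematicalPhysics.QuantumFieldTheory.Balaban1983to89.BlockAveraging (blockAvg Idx)
open Literature.MathematicalPhysics.QuantumFieldTheory.Balaban1983to89.B9AdOrthogonal (σ₃)
open Summit.QuantumFields.Balaban3D.Carriers (suGroupModel)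
open Summit.QuantumFields.YangMills.Theorems.BalabanUVNodesN08AlphaAbelianLift (gexp)
open Summit.QuantumFields.YangMills.Theorems.AbelianEML (gexpAt linAvgIter linAvgIter_succ loopSum curlAt iter_blockAvg_gexpAt blockAvg_gexpAt_apply dist1_loopHol_gexpAt_le
  coe_gexp_su)
open Summit.QuantumFields.YangMills.Theorems.AvgActionDefect (deltaSU_fin_two)
open Summit.QuantumFields.YangMills.Theorems.Prop7SymCentreAbelianDict (I_smul_sigma3_mem_lie)

/-! ## §1 Any `SU(N)`, any one-parameter direction: the descent of an abelian configuration is the abelian configuration of the linear average -/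

section General

variable (F : T3Family) {n K : ℕ} {N : ℕ} [NeZero N] {Y : Matrix (Fin N) (Fin N) ℂ} (hY : Y ∈ (suGroupModel N).lie)

/-- ★★ **THE DESCENT OF AN ABELIAN CONFIGURATION IS EXACT**: for a finest real one-form `a` of the `K`-th approximation whose lattice curls are `≤ B` everywhere, under the
curl guard `(π/2)·(((d+2)L)²/4)·(L²)^{K−n}·B·‖Y‖ < min(δ_N, ln 2)`, the `(K−n)`-fold printed block averaging read on the `n`-th tower of `b ↦ exp(a_b·Y)` is
`c ↦ exp((linAvgIter (K−n) a)(ĉ)·Y)`, `ĉ = bondShift (sites_eq F n K h) c`. [cite: Balaban1987RG1, (0.4)+(0.11) p.253] -/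
theorem descendTo_gexpAt_eq_fieldShift (hY0 : Y ≠ 0) (h : n ≤ K) (a : PBond (F.P K) 0 → ℝ) {B : ℝ} (hB0 : 0 ≤ B)
    (hBall : ∀ (x : Site (F.P K) 0) (μ ν : Fin (F.P K).d), |curlAt a x μ ν| ≤ B)
    (hthr : Real.pi / 2 * ((((((F.P K).d + 2) * (F.P K).L : ℕ) : ℝ) ^ 2 / 4) * ((((F.P K).L : ℝ) ^ 2) ^ (K - n) * B)) * ‖Y‖ <
      min (deltaSU (Fin N)) (Real.log 2)) :
    descendTo F (expMeanLogSU (n := Fin N)) n K h (gexpAt (suGroupModel N) hY a) =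
      fieldShift (sites_eq F n K h) (gexpAt (suGroupModel N) hY (linAvgIter (K - n) a)) := by
  have hiter := iter_blockAvg_gexpAt hY hY0 a hB0 hBall (K - n) hthr
  unfold descendTo
  exact congrArg (fieldShift _) hiter

/-- ★★ **FIBRE MEMBERSHIP**: if moreover the `(K−n)`-fold linear average of `a`, read on the `n`-th tower, is the coarse angle field `θ`, then `b ↦ exp(a_b·Y)` lies in the
averaging fibre of `c ↦ exp(θ_c·Y)`. [cite: Balaban1987RG1, (0.4)+(0.11) p.253; Balaban1985Variational, (2) p.278] -/
theorem gexpAt_mem_fibre_gexpAt (hY0 : Y ≠ 0) (h : n ≤ K) (a : PBond (F.P K) 0 → ℝ) {B : ℝ} (hB0 : 0 ≤ B)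
    (hBall : ∀ (x : Site (F.P K) 0) (μ ν : Fin (F.P K).d), |curlAt a x μ ν| ≤ B)
    (hthr : Real.pi / 2 * ((((((F.P K).d + 2) * (F.P K).L : ℕ) : ℝ) ^ 2 / 4) * ((((F.P K).L : ℝ) ^ 2) ^ (K - n) * B)) * ‖Y‖ <
      min (deltaSU (Fin N)) (Real.log 2))
    (θ : PBond (F.P n) 0 → ℝ) (hθ : ∀ c : PBond (F.P n) 0, linAvgIter (K - n) a (bondShift (sites_eq F n K h) c) = θ c) :
    gexpAt (suGroupModel N) hY a ∈ fibre F (expMeanLogSU (n := Fin N)) n K h (gexpAt (suGroupModel N) hY θ) := by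
  show descendTo F _ n K h _ = _
  rw [descendTo_gexpAt_eq_fieldShift F hY hY0 h a hB0 hBall hthr]
  funext c
  rw [fieldShift_apply]
  show gexp _ hY (linAvgIter (K - n) a (bondShift (sites_eq F n K h) c)) = gexp _ hY (θ c)
  rw [hθ c]

/-- **THE GAUGE-TRANSPORTED FORM**: `u • exp(a·Y)` lies in the fibre of `u↓ • exp(θ·Y)` (`u↓ = descTransf F n K h u`; covariance of the descent, ✓`gaugeAct_mem_fibre_iff`).
[cite: Balaban1985Variational, (3)-(4) p.278; Balaban1985Averaging, (11) p.19] -/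
theorem gaugeAct_gexpAt_mem_fibre (hY0 : Y ≠ 0) (h : n ≤ K) (a : PBond (F.P K) 0 → ℝ) {B : ℝ} (hB0 : 0 ≤ B)
    (hBall : ∀ (x : Site (F.P K) 0) (μ ν : Fin (F.P K).d), |curlAt a x μ ν| ≤ B)
    (hthr : Real.pi / 2 * ((((((F.P K).d + 2) * (F.P K).L : ℕ) : ℝ) ^ 2 / 4) * ((((F.P K).L : ℝ) ^ 2) ^ (K - n) * B)) * ‖Y‖ <
      min (deltaSU (Fin N)) (Real.log 2))
    (θ : PBond (F.P n) 0 → ℝ) (hθ : ∀ c : PBond (F.P n) 0, linAvgIter (K - n) a (bondShift (sites_eq F n K h) c) = θ c)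
    (u : GaugeTransf (F.P K) 0 (Matrix.specialUnitaryGroup (Fin N) ℂ)) :
    GaugeField.gaugeAct u (gexpAt (suGroupModel N) hY a) ∈
      fibre F (expMeanLogSU (n := Fin N)) n K h (GaugeField.gaugeAct (descTransf F n K h u) (gexpAt (suGroupModel N) hY θ)) :=
  (gaugeAct_mem_fibre_iff F h (expMeanLogSU (n := Fin N)) u _ _).2 (gexpAt_mem_fibre_gexpAt F hY hY0 h a hB0 hBall hthr θ hθ)


/-! ### §1c The loop-sum-guard form: the pointwise principal-log guards at every level suffice (e.g. a flux cochain in standard form, whose (0.4) loops avoid the corner column) -/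

/-- ★★ **THE TOWER FROM POINTWISE LOOP-SUM GUARDS** (generic torus `P`): if at every level `s < k` every (0.4) loop sum of `linAvgIter s a` satisfies `|Σ|·‖Y‖ < min(δ_N, ln 2)`, then
`(blockAvg expMeanLogSU)^k (exp(a·Y)) = exp((linAvgIter k a)·Y)` — ★alpha-2's induction (✓`iter_blockAvg_gexpAt`) with the global curl row replaced by the pointwise guards of
✓`blockAvg_gexpAt_apply` (no curl hypothesis at all: a flux cochain whose Dirac column is avoided by every loop's Stokes surface qualifies). [cite: Balaban1987RG1, (0.4)+(0.11) p.253] -/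
theorem iter_blockAvg_gexpAt_of_loopSum_lt {P : Params} (k : ℕ) (a : PBond P 0 → ℝ)
    (hloop : ∀ s, s < k → ∀ (c : PBond P (s + 1)) (i : Idx P), |loopSum (linAvgIter s a) c i| * ‖Y‖ < min (deltaSU (Fin N)) (Real.log 2)) :
    Averaging.iter (fun i => blockAvg (P := P) (j := i) (expMeanLogSU (n := Fin N))) k (gexpAt (suGroupModel N) hY a) =
      gexpAt (suGroupModel N) hY (linAvgIter k a) := by
  induction k with
  | zero => rfl
  | succ k ih =>
    have ih' := ih fun s hs => hloop s (Nat.lt_succ_of_lt hs)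
    show (blockAvg (P := P) (j := k) (expMeanLogSU (n := Fin N))).avg (Averaging.iter _ k _) = _
    rw [ih', linAvgIter_succ]
    funext c
    exact blockAvg_gexpAt_apply hY (linAvgIter k a) c
      (fun i => (dist1_loopHol_gexpAt_le (suGroupModel N) hY _ c i).trans_lt ((hloop k k.lt_succ_self c i).trans_le (min_le_left _ _)))
      (fun i => (hloop k k.lt_succ_self c i).trans_le (min_le_right _ _))

/-- ★★ **THE DESCENT FROM POINTWISE LOOP-SUM GUARDS**: `descendTo F 𝓔 n K h (exp(a·Y)) = fieldShift (sites_eq F n K h) (exp((linAvgIter (K−n) a)·Y))` whenever the level-`s` loop sums of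
`linAvgIter s a` obey `|Σ|·‖Y‖ < min(δ_N, ln 2)` for every `s < K − n`. [cite: Balaban1987RG1, (0.4)+(0.11) p.253] -/
theorem descendTo_gexpAt_eq_fieldShift_of_loopSum_lt (h : n ≤ K) (a : PBond (F.P K) 0 → ℝ)
    (hloop : ∀ s, s < K - n → ∀ (c : PBond (F.P K) (s + 1)) (i : Idx (F.P K)),
      |loopSum (linAvgIter s a) c i| * ‖Y‖ < min (deltaSU (Fin N)) (Real.log 2)) :
    descendTo F (expMeanLogSU (n := Fin N)) n K h (gexpAt (suGroupModel N) hY a) =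
      fieldShift (sites_eq F n K h) (gexpAt (suGroupModel N) hY (linAvgIter (K - n) a)) := by
  have hiter := iter_blockAvg_gexpAt_of_loopSum_lt (P := F.P K) hY (K - n) a hloop
  unfold descendTo
  exact congrArg (fieldShift _) hiter

/-- Fibre membership from pointwise loop-sum guards. [cite: Balaban1987RG1, (0.11) p.253; Balaban1985Variational, (2) p.278] -/
theorem gexpAt_mem_fibre_gexpAt_of_loopSum_lt (h : n ≤ K) (a : PBond (F.P K) 0 → ℝ)
    (hloop : ∀ s, s < K - n → ∀ (c : PBond (F.P K) (s + 1)) (i : Idx (F.P K)),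
      |loopSum (linAvgIter s a) c i| * ‖Y‖ < min (deltaSU (Fin N)) (Real.log 2))
    (θ : PBond (F.P n) 0 → ℝ) (hθ : ∀ c : PBond (F.P n) 0, linAvgIter (K - n) a (bondShift (sites_eq F n K h) c) = θ c) :
    gexpAt (suGroupModel N) hY a ∈ fibre F (expMeanLogSU (n := Fin N)) n K h (gexpAt (suGroupModel N) hY θ) := by
  show descendTo F _ n K h _ = _
  rw [descendTo_gexpAt_eq_fieldShift_of_loopSum_lt F hY h a hloop]
  funext c
  rw [fieldShift_apply]
  show gexp _ hY (linAvgIter (K - n) a (bondShift (sites_eq F n K h) c)) = gexp _ hY (θ c)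
  rw [hθ c]

end General

/-! ## §2 The diagonal direction `iσ₃` of `𝔰𝔲(2)` -/

section Sigma3
/-- `iσ₃ = diag(i, −i)`. [folklore] -/
theorem I_smul_sigma3_eq_diagonal : (Complex.I • σ₃ : Matrix (Fin 2) (Fin 2) ℂ) = Matrix.diagonal ![Complex.I, -Complex.I] := by
  ext i j
  fin_cases i <;> fin_cases j <;> simp [σ₃]

/-- `iσ₃ ≠ 0`. [folklore] -/
theorem I_smul_sigma3_ne_zero : (Complex.I • σ₃ : Matrix (Fin 2) (Fin 2) ℂ) ≠ 0 := by
  intro h0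
  have h00 := congrFun (congrFun h0 0) 0
  simp [σ₃] at h00

/-- `‖iσ₃‖ = 1` (operator norm; `σ₃` is unitary). [folklore] -/
theorem norm_I_smul_sigma3 : ‖(Complex.I • σ₃ : Matrix (Fin 2) (Fin 2) ℂ)‖ = 1 := by
  rw [norm_smul, Complex.norm_I, one_mul]
  have hu : (σ₃ : Matrix (Fin 2) (Fin 2) ℂ) ∈ unitary (Matrix (Fin 2) (Fin 2) ℂ) := by
    rw [Unitary.mem_iff]
    constructor <;>
    · ext i j
      fin_cases i <;> fin_cases j <;> simp [σ₃, Matrix.mul_apply, Matrix.star_apply]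
  exact CStarRing.norm_of_mem_unitary hu

/-- ★ **THE ONE-PARAMETER SUBGROUP OF `iσ₃` IS THE DIAGONAL TORUS**: `exp(t·iσ₃) = diag(e^{it}, e^{−it})`. [folklore] -/
theorem coe_gexp_I_smul_sigma3 (t : ℝ) :
    ((gexp (suGroupModel 2) I_smul_sigma3_mem_lie t : Matrix.specialUnitaryGroup (Fin 2) ℂ) : Matrix (Fin 2) (Fin 2) ℂ) =
      Matrix.diagonal ![Complex.exp (Complex.I * t), Complex.exp (-(Complex.I * t))] := by
  rw [coe_gexp_su, I_smul_sigma3_eq_diagonal]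
  have hdiag : ((t : ℝ) : ℂ) • (Matrix.diagonal ![Complex.I, -Complex.I] : Matrix (Fin 2) (Fin 2) ℂ) =
      Matrix.diagonal ![Complex.I * t, -(Complex.I * t)] := by
    rw [← Matrix.diagonal_smul]
    congr 1
    funext i
    fin_cases i <;> simp [mul_comm]
  rw [hdiag, Matrix.exp_diagonal]
  congr 1
  funext i
  rw [Pi.coe_exp]
  fin_cases i <;> simp [Complex.exp_eq_exp_ℂ]

/-- The diagonal torus commutes with `σ₃`. [folklore] -/
theorem commute_coe_gexp_I_smul_sigma3_sigma3 (t : ℝ) :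
    Commute ((gexp (suGroupModel 2) I_smul_sigma3_mem_lie t : Matrix.specialUnitaryGroup (Fin 2) ℂ) : Matrix (Fin 2) (Fin 2) ℂ) σ₃ := by
  rw [coe_gexp_I_smul_sigma3, show (σ₃ : Matrix (Fin 2) (Fin 2) ℂ) = Matrix.diagonal ![1, -1] from by
    ext i j; fin_cases i <;> fin_cases j <;> simp [σ₃]]
  show Matrix.diagonal _ * Matrix.diagonal _ = Matrix.diagonal _ * Matrix.diagonal _
  rw [Matrix.diagonal_mul_diagonal, Matrix.diagonal_mul_diagonal]
  congr 1
  funext i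
  exact mul_comm _ _

/-- ★ **AN `SU(2)` ELEMENT COMMUTING WITH `σ₃` IS ON THE DIAGONAL TORUS**: `U σ₃ = σ₃ U ⇒ U = exp(θ·iσ₃)` for a real `θ` (off-diagonal entries vanish; `|U₀₀| = 1`,
`U₁₁ = U₀₀⁻¹`; `θ := arg U₀₀`). [folklore] -/
theorem exists_eq_gexp_of_commute_sigma3 (U : Matrix.specialUnitaryGroup (Fin 2) ℂ)
    (hU : Commute ((U : Matrix.specialUnitaryGroup (Fin 2) ℂ) : Matrix (Fin 2) (Fin 2) ℂ) σ₃) :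
    ∃ θ : ℝ, U = gexp (suGroupModel 2) I_smul_sigma3_mem_lie θ := by
  have hc := hU.eq
  -- the off-diagonal entries vanish
  have h01 : (U : Matrix (Fin 2) (Fin 2) ℂ) 0 1 = 0 := by
    have h := congrFun (congrFun hc 0) 1
    simp only [σ₃, Matrix.mul_apply, Fin.sum_univ_two, Matrix.of_apply, Matrix.cons_val', Matrix.cons_val_zero, Matrix.cons_val_one,
      Matrix.cons_val_fin_one, Matrix.empty_val', mul_one, mul_zero, mul_neg, zero_add, add_zero, one_mul, zero_mul] at h
    linear_combination (-(1 : ℂ) / 2) * h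
  have h10 : (U : Matrix (Fin 2) (Fin 2) ℂ) 1 0 = 0 := by
    have h := congrFun (congrFun hc 1) 0
    simp only [σ₃, Matrix.mul_apply, Fin.sum_univ_two, Matrix.of_apply, Matrix.cons_val', Matrix.cons_val_zero, Matrix.cons_val_one,
      Matrix.cons_val_fin_one, Matrix.empty_val', mul_one, mul_zero, zero_add, add_zero, one_mul, zero_mul, neg_mul] at h
    linear_combination (1 : ℂ) / 2 * h
  -- unitarity and determinant one
  obtain ⟨hunit, hdet⟩ := Matrix.mem_specialUnitaryGroup_iff.1 U.2
  have hstar : star (U : Matrix (Fin 2) (Fin 2) ℂ) * (U : Matrix (Fin 2) (Fin 2) ℂ) = 1 := Matrix.mem_unitaryGroup_iff'.1 hunit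
  have h00 : starRingEnd ℂ ((U : Matrix (Fin 2) (Fin 2) ℂ) 0 0) * (U : Matrix (Fin 2) (Fin 2) ℂ) 0 0 = 1 := by
    have h := congrFun (congrFun hstar 0) 0
    rw [Matrix.star_eq_conjTranspose, Matrix.mul_apply, Fin.sum_univ_two, Matrix.conjTranspose_apply, Matrix.conjTranspose_apply, h10,
      Matrix.one_apply_eq] at h
    simpa using h
  have hdet' : (U : Matrix (Fin 2) (Fin 2) ℂ) 0 0 * (U : Matrix (Fin 2) (Fin 2) ℂ) 1 1 = 1 := by
    rw [Matrix.det_fin_two, h01, zero_mul, sub_zero] at hdet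
    exact hdet
  have hnorm : ‖(U : Matrix (Fin 2) (Fin 2) ℂ) 0 0‖ = 1 := by
    have h2 : ‖(U : Matrix (Fin 2) (Fin 2) ℂ) 0 0‖ ^ 2 = 1 := by
      rw [← Complex.normSq_eq_norm_sq, ← Complex.ofReal_inj, Complex.ofReal_one, Complex.normSq_eq_conj_mul_self]
      exact h00
    nlinarith [norm_nonneg ((U : Matrix (Fin 2) (Fin 2) ℂ) 0 0)]
  refine ⟨Complex.arg ((U : Matrix (Fin 2) (Fin 2) ℂ) 0 0), Subtype.ext ?_⟩
  rw [coe_gexp_I_smul_sigma3]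
  have he : Complex.exp (Complex.I * (Complex.arg ((U : Matrix (Fin 2) (Fin 2) ℂ) 0 0) : ℝ)) = (U : Matrix (Fin 2) (Fin 2) ℂ) 0 0 := by
    have h := Complex.norm_mul_exp_arg_mul_I ((U : Matrix (Fin 2) (Fin 2) ℂ) 0 0)
    rw [hnorm, Complex.ofReal_one, one_mul, mul_comm] at h
    exact h
  have he' : Complex.exp (-(Complex.I * (Complex.arg ((U : Matrix (Fin 2) (Fin 2) ℂ) 0 0) : ℝ))) = (U : Matrix (Fin 2) (Fin 2) ℂ) 1 1 := by
    rw [Complex.exp_neg, he]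
    exact inv_eq_of_mul_eq_one_right hdet'
  ext i j
  fin_cases i <;> fin_cases j <;> simp [he, he', h01, h10]

/-- **A σ₃-DIAGONAL `SU(2)`-VALUED FIELD IS AN ABELIAN CONFIGURATION ALONG `iσ₃`** (the letters of ✓`exists_symCentre_of_diagonalSupplier`'s supplier hypothesis):
`∀ e, U(e) σ₃ = σ₃ U(e) ⇒ U = gexpAt (iσ₃) θ` for a real angle field `θ`. [cite: Balaban1985Variational, (2) p.278] -/
theorem exists_eq_gexpAt_of_forall_commute_sigma3 {P : Params} {j : ℕ} (V : GaugeField P j (Matrix.specialUnitaryGroup (Fin 2) ℂ))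
    (hV : ∀ e : PBond P j, Commute ((V e : Matrix.specialUnitaryGroup (Fin 2) ℂ) : Matrix (Fin 2) (Fin 2) ℂ) σ₃) :
    ∃ θ : PBond P j → ℝ, V = gexpAt (suGroupModel 2) I_smul_sigma3_mem_lie θ := by
  choose θ hθ using fun e => exists_eq_gexp_of_commute_sigma3 (V e) (hV e)
  exact ⟨θ, funext hθ⟩

/-- Conversely the bond variables of `gexpAt (iσ₃) θ` commute with `σ₃`. [folklore] -/
theorem commute_coe_gexpAt_sigma3 {P : Params} {j : ℕ} (θ : PBond P j → ℝ) (e : PBond P j) :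
    Commute ((gexpAt (suGroupModel 2) I_smul_sigma3_mem_lie θ e : Matrix.specialUnitaryGroup (Fin 2) ℂ) : Matrix (Fin 2) (Fin 2) ℂ) σ₃ :=
  commute_coe_gexp_I_smul_sigma3_sigma3 (θ e)


/-- **2π-PERIODICITY OF THE DIAGONAL TORUS**: `exp((t + 2πj)·iσ₃) = exp(t·iσ₃)` for an integer `j` — moving a Dirac string of a flux cochain by `2π·(ℤ-valued cochain)` does not change the
`SU(2)`-field. [folklore] -/
theorem gexp_I_smul_sigma3_add_two_pi_mul_int (t : ℝ) (j : ℤ) :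
    gexp (suGroupModel 2) I_smul_sigma3_mem_lie (t + 2 * Real.pi * j) = gexp (suGroupModel 2) I_smul_sigma3_mem_lie t := by
  apply Subtype.ext
  rw [coe_gexp_I_smul_sigma3, coe_gexp_I_smul_sigma3]
  have h1 : Complex.exp (Complex.I * ((t + 2 * Real.pi * j : ℝ) : ℂ)) = Complex.exp (Complex.I * (t : ℂ)) := by
    push_cast
    rw [mul_add, Complex.exp_add, show Complex.I * (2 * (Real.pi : ℂ) * (j : ℂ)) = (j : ℂ) * (2 * Real.pi * Complex.I) by ring,
      Complex.exp_int_mul_two_pi_mul_I, mul_one]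
  have h2 : Complex.exp (-(Complex.I * ((t + 2 * Real.pi * j : ℝ) : ℂ))) = Complex.exp (-(Complex.I * (t : ℂ))) := by
    rw [Complex.exp_neg, Complex.exp_neg, h1]
  rw [h1, h2]

/-- The same for fields: `gexpAt (iσ₃) (a + 2π·j) = gexpAt (iσ₃) a` for every `ℤ`-valued cochain `j`. [folklore] -/
theorem gexpAt_I_smul_sigma3_add_two_pi_mul_int {P : Params} {j : ℕ} (a : PBond P j → ℝ) (m : PBond P j → ℤ) :
    gexpAt (suGroupModel 2) I_smul_sigma3_mem_lie (fun b => a b + 2 * Real.pi * (m b : ℝ)) = gexpAt (suGroupModel 2) I_smul_sigma3_mem_lie a := by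
  funext b
  exact gexp_I_smul_sigma3_add_two_pi_mul_int (a b) (m b)

end Sigma3

/-! ## §3 T³ letters (`ℰp`, `SU(2)`, direction `iσ₃`, numeric window): R4-FIBRE as worded -/

section T3

variable (F : T3Family) {n K : ℕ}

/-- The numeric window `30·L²·(L²)^{K−n}·B ≤ 1` implies the curl guard of ✓`iter_blockAvg_gexpAt`(`_region`) at every level `s ≤ K − n` (`d = 3`, `N = 2`, `‖iσ₃‖ = 1`; local
arithmetic: `(π/2)(25/4)/30 < 1/3 = δ₂ < ln 2`). [folklore] -/
theorem curlGuard_of_window_T3 {B : ℝ} (hB0 : 0 ≤ B) (hwin : 30 * (F.L : ℝ) ^ 2 * ((((F.L : ℝ) ^ 2) ^ (K - n)) * B) ≤ 1) {s : ℕ} (hs : s ≤ K - n) :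
    Real.pi / 2 * ((((((F.P K).d + 2) * (F.P K).L : ℕ) : ℝ) ^ 2 / 4) * ((((F.P K).L : ℝ) ^ 2) ^ s * B)) *
        ‖(Complex.I • σ₃ : Matrix (Fin 2) (Fin 2) ℂ)‖ < min (deltaSU (Fin 2)) (Real.log 2) := by
  have hd : (F.P K).d = 3 := rfl
  have hL : (F.P K).L = F.L := rfl
  rw [hd, hL, norm_I_smul_sigma3, mul_one, deltaSU_fin_two,
    min_eq_left (by have := Real.log_two_gt_d9; norm_num at this ⊢; linarith)]
  have hL1 : (1 : ℝ) ≤ (F.L : ℝ) ^ 2 := one_le_pow₀ (by exact_mod_cast F.hL.2.le)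
  have hmono : (((F.L : ℝ) ^ 2) ^ s) * B ≤ (((F.L : ℝ) ^ 2) ^ (K - n)) * B := mul_le_mul_of_nonneg_right (pow_le_pow_right₀ hL1 hs) hB0
  have hX0 : 0 ≤ (((F.L : ℝ) ^ 2) ^ s) * B := by positivity
  have hpi := Real.pi_lt_d2
  have h5 : ((((3 + 2) * F.L : ℕ) : ℝ)) ^ 2 / 4 = 25 / 4 * (F.L : ℝ) ^ 2 := by push_cast; ring
  rw [h5]
  have hsq : 0 ≤ (F.L : ℝ) ^ 2 := sq_nonneg _
  nlinarith [mul_le_mul_of_nonneg_left hmono hsq, mul_nonneg hsq hX0]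

/-- ★★★ **R4-FIBRE, EQUATION FORM**: for a finest real one-form `a` on run `K` with `|curl a| ≤ B` (all positions, all `μ ≠ ν`) and `30·L²·(L²)^{K−n}·B ≤ 1`, the diagonal field
`U_a b := diag(e^{i a_b}, e^{−i a_b})` averages EXACTLY: `descendTo F ℰp n K h U_a = (c ↦ diag(e^{iθ(ĉ)}, e^{−iθ(ĉ)}))`, `θ := linAvgIter (K−n) a`, `ĉ = bondShift (sites_eq F n K h) c`.
[cite: Balaban1987RG1, (0.4)+(0.11) p.253] -/
theorem descendTo_diag_eq_T3 (h : n ≤ K) (a : PBond (F.P K) 0 → ℝ) {B : ℝ} (hB0 : 0 ≤ B)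
    (hcurl : ∀ (x : Site (F.P K) 0) (μ ν : Fin (F.P K).d), μ ≠ ν → |curlAt a x μ ν| ≤ B)
    (hwin : 30 * (F.L : ℝ) ^ 2 * ((((F.L : ℝ) ^ 2) ^ (K - n)) * B) ≤ 1) :
    descendTo F ℰp n K h (gexpAt (suGroupModel 2) I_smul_sigma3_mem_lie a) =
      fieldShift (sites_eq F n K h) (gexpAt (suGroupModel 2) I_smul_sigma3_mem_lie (linAvgIter (K - n) a)) := by
  have hBall : ∀ (x : Site (F.P K) 0) (μ ν : Fin (F.P K).d), |curlAt a x μ ν| ≤ B := by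
    intro x μ ν
    by_cases hμν : μ = ν
    · subst hμν
      have h0 : curlAt a x μ μ = 0 := by unfold curlAt; ring
      rw [h0, abs_zero]; exact hB0
    · exact hcurl x μ ν hμν
  exact descendTo_gexpAt_eq_fieldShift F I_smul_sigma3_mem_lie I_smul_sigma3_ne_zero h a hB0 hBall (curlGuard_of_window_T3 F hB0 hwin le_rfl)

/-- ★★★ **R4-FIBRE (★px20 g2's wording)**: for a finest real one-form `a` with `linAvgIter (K−n) a = θ` read on the `n`-th tower (✓p674080's exact average), `|curl a| ≤ B`
(`μ ≠ ν`) and `30·L²·(L²)^{K−n}·B ≤ 1`, the DIAGONAL field `U_a b := diag(e^{i a_b}, e^{−i a_b}) ∈ SU(2)` lies in `fibre F ℰp n K h V_θ`, `V_θ c := diag(e^{iθ_c}, e^{−iθ_c})`.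
With ✓`exists_smoothExactLift_torus` (`B = 54³·ε/(L^{K−n})²`) the window is `30·54³·L²·ε ≤ 1`, uniform in `K − n`. [cite: Balaban1987RG1, (0.4)+(0.11) p.253; Balaban1985Variational, (2) p.278] -/
theorem diag_mem_fibre_diag_T3 (h : n ≤ K) (a : PBond (F.P K) 0 → ℝ) (θ : PBond (F.P n) 0 → ℝ) {B : ℝ} (hB0 : 0 ≤ B)
    (hcurl : ∀ (x : Site (F.P K) 0) (μ ν : Fin (F.P K).d), μ ≠ ν → |curlAt a x μ ν| ≤ B)
    (hwin : 30 * (F.L : ℝ) ^ 2 * ((((F.L : ℝ) ^ 2) ^ (K - n)) * B) ≤ 1)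
    (hθ : ∀ c : PBond (F.P n) 0, linAvgIter (K - n) a (bondShift (sites_eq F n K h) c) = θ c) :
    gexpAt (suGroupModel 2) I_smul_sigma3_mem_lie a ∈ fibre F ℰp n K h (gexpAt (suGroupModel 2) I_smul_sigma3_mem_lie θ) := by
  show descendTo F _ n K h _ = _
  rw [descendTo_diag_eq_T3 F h a hB0 hcurl hwin]
  funext c
  rw [fieldShift_apply]
  show gexp _ _ (linAvgIter (K - n) a (bondShift (sites_eq F n K h) c)) = gexp _ _ (θ c)
  rw [hθ c]

/-- **R4-FIBRE, gauge-transported**: `u • U_a ∈ fibre F ℰp n K h (u↓ • V_θ)` for every fine gauge transformation `u` (`u↓ = descTransf F n K h u`; with ★px6's diagonalising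
coarse gauge lifted by ✓`liftTransfTo` this is the reducible member's centre before ✓`symCentre_gaugeAct`). [cite: Balaban1985Variational, (3)-(4) p.278; Balaban1985Averaging, (11)-(12) p.19] -/
theorem gaugeAct_diag_mem_fibre_T3 (h : n ≤ K) (a : PBond (F.P K) 0 → ℝ) (θ : PBond (F.P n) 0 → ℝ) {B : ℝ} (hB0 : 0 ≤ B)
    (hcurl : ∀ (x : Site (F.P K) 0) (μ ν : Fin (F.P K).d), μ ≠ ν → |curlAt a x μ ν| ≤ B)
    (hwin : 30 * (F.L : ℝ) ^ 2 * ((((F.L : ℝ) ^ 2) ^ (K - n)) * B) ≤ 1)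
    (hθ : ∀ c : PBond (F.P n) 0, linAvgIter (K - n) a (bondShift (sites_eq F n K h) c) = θ c)
    (u : GaugeTransf (F.P K) 0 (Matrix.specialUnitaryGroup (Fin 2) ℂ)) :
    GaugeField.gaugeAct u (gexpAt (suGroupModel 2) I_smul_sigma3_mem_lie a) ∈
      fibre F ℰp n K h (GaugeField.gaugeAct (descTransf F n K h u) (gexpAt (suGroupModel 2) I_smul_sigma3_mem_lie θ)) :=
  (gaugeAct_mem_fibre_iff F h ℰp u _ _).2 (diag_mem_fibre_diag_T3 F h a θ hB0 hcurl hwin hθ)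


/-- ★★★ **R4-FIBRE FROM POINTWISE LOOP-SUM GUARDS** (for the flux sector in standard form, ★w5-20520 g8's located corner-avoidance): if `3·|loopSum (linAvgIter s a) c i| < 1` for every
level `s < K − n`, every level-`(s+1)` bond `c` and every loop index `i`, and `linAvgIter (K−n) a (ĉ) = θ c`, then `U_a ∈ fibre F ℰp n K h V_θ` — NO curl hypothesis.
[cite: Balaban1987RG1, (0.4)+(0.11) p.253; Balaban1985Variational, (2) p.278] -/
theorem diag_mem_fibre_diag_of_loopSum_T3 (h : n ≤ K) (a : PBond (F.P K) 0 → ℝ) (θ : PBond (F.P n) 0 → ℝ)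
    (hloop : ∀ s, s < K - n → ∀ (c : PBond (F.P K) (s + 1)) (i : Idx (F.P K)), 3 * |loopSum (linAvgIter s a) c i| < 1)
    (hθ : ∀ c : PBond (F.P n) 0, linAvgIter (K - n) a (bondShift (sites_eq F n K h) c) = θ c) :
    gexpAt (suGroupModel 2) I_smul_sigma3_mem_lie a ∈ fibre F ℰp n K h (gexpAt (suGroupModel 2) I_smul_sigma3_mem_lie θ) := by
  refine gexpAt_mem_fibre_gexpAt_of_loopSum_lt F I_smul_sigma3_mem_lie h a (fun s hs c i => ?_) θ hθ
  rw [norm_I_smul_sigma3, mul_one, deltaSU_fin_two, min_eq_left (by have := Real.log_two_gt_d9; norm_num at this ⊢; linarith)]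
  have := hloop s hs c i
  linarith

end T3

end Summit.QuantumFields.YangMills.Theorems.Prop7SymCentreAbelianFibre

end
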